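import Literature.MathematicalPhysics.QuantumFieldTheory.Balaban1983to89.B8Prop3MultiLevelTorusLapL0
import Literature.MathematicalPhysics.QuantumFieldTheory.Balaban1983to89.B6Prop26GradKLevelV1L3

/-!
# `Balaban1983to89.B8Prop3MultiLevelTorusP26L3` — THE `L ≥ 3` TWIN of the endpoint `B8Prop3MultiLevelTorusP26L0.prop3_multiLevelTorus_V1_P26_vector`
# (T. Bałaban, *Spaces of regular gauge field configurations on a lattice and gauge fixing conditions*, Commun. Math. Phys. **99** (1985) 75–102
# [Balaban1985RegularSpaces], **PROPOSITION 3** p. 87 ∕ **(1.59)** p. 86 AT THE FLAT BACKGROUND `U₀ = 1` ON THE `k`-LEVEL V1 TORUS WITH print's region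
# `Λ₀ = T ∖ Ω₁` admitted, vector side, NO [B6]-side hypothesis) — NOW FOR EVERY ODD `L ≥ 3`

statement-level skeleton of published theorems with citation tags; proofs where landed; nothing here is a claim about the Yang–Mills mass gap

WHY THIS FILE.  The L0 endpoint (`lit-balaban-r05` gen 76, sub-row G-F3′-L0∕B8 «N05 cone», ME #33) carries the binder `(_ : 4 ≤ ℓ)` (block size
`L = ℓ + 1 ≥ 5`) for ONE reason: it hands it to p38's producer `B6Prop26GradKLevelV1L0.prop26_2136_grad_kLevel_unconditional_pad_V1` of the two
(2.136) majorants (for `G(1)` and `∇G(1)`).  The lit-balaban V1L3 lineage (r03 ∕ p33 ∕ p21, design (B′) «re-centre the cube in its 2L-block window»,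
milestone 2026-08-28T00:15Z) landed the SAME producer WITHOUT that binder: `B6Prop26GradKLevelV1L3.prop26_2136_grad_kLevel_unconditional_pad_V1`
(statement = the L0 one minus `(_ : 4 ≤ ℓ)`, on the same carriers `B6MultiLevelTorusOperatorL0.TDomains` ∕ `domT` ∕ `GE` ∕ `geomT` ∕ `blkV1`).  The B8-side
reading `B8Prop3MultiLevelTorusLapL0.prop3_multiLevelTorus_V1_pref_vecLap` never read the floor.  So the §8 proof of the L0 file goes through VERBATIM with
the V1L3 producer: ★ `prop3_multiLevelTorus_V1_P26_vector_L3` — PROPOSITION 3 AT `U₀ = 1` ON THE `k`-LEVEL V1 TORUS, EVERY ODD `L ≥ 3`, `k ≥ 1`, `P′ ≥ 5L`,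
NO [B6]-SIDE HYPOTHESIS; binders = the L0 endpoint's minus `(_ : 4 ≤ ℓ)`, conclusions VERBATIM (the seven of Prop. 3 ∕ (1.59) with
`B₀′ = K_L(B₀A + 1)(1 + 2b₁)` and `∇ = DV · c′`).  The L0 endpoint is the `4 ≤ ℓ` special case.  Consumer: dag-n05-c's transplant of the named flat fact
`B8Ineq159FlatCubeMemberPrinted.Ineq159FlatCubeMemberPrinted` (its twin `B8Ineq159FlatCubeMemberTransplantL3`), hence [B8] Prop. 6 at odd `L ≥ 3`.

HONEST SCOPE.  Pure plumbing (one `obtain` re-pointed); no module of the L0 ∕ V1L3 lineages is touched; no fact is minted; nothing of print is asserted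
beyond what the two landed inputs prove.  The `U(1)` members §9–§10 of `B8Prop3MultiLevelTorusP26` are NOT twinned (not needed by the consumer).
One finite-lattice statement at fixed `η`; nothing continuum ∕ ℝ⁴ ∕ OS ∕ mass-gap ∕ Clay.  No `sorry`, no `def`, no `instance`, no `notation`.
Cell `pub∕ym-inputs` seat `ym-inputs-p06` g2 (ym3-torus L-FLOOR LEDGER, Prop-6 component), 2026-08-28.

PDF held: `paper:balaban1985-cmp99-regular-spaces-gauge-fixing` (journal page = PDF page + 74): Prop. 3 p. 87, (1.59)–(1.62) pp. 86–87, (1.55)–(1.58) p. 86,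
(1.42) p. 84.  [B6] = [Balaban1984PropagatorsII] Prop. 2.6 (2.136) p. 247, (2.92) p. 239, Lemma 2.1 p. 234.
-/

open scoped BigOperators
open Finset

namespace Literature.MathematicalPhysics.QuantumFieldTheory.Balaban1983to89.B8Prop3MultiLevelTorusP26L3

open B6MultiLevelBoxOperator (N0)
open B6MultiLevelTorusOperatorL0 (TDomains)
open B6Geom246MultiLevelTorusL0 (geomT)
open B6RandomWalk (HasMajorant delta3 delta3_pos)
open B6Ineq2133TwoScaleV1 (onFun)
open B6GlobalChartV1 (PV)
open B6GlobalChartV1L0 (domT blkV1)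
open B6SectAOperatorsV1 (dsE dcE dcsE QE RE BondIdx BondIdxSpace)
open B6SectAVectorModelV1 (GE)
open B6Prop26KLevelSkeletonV1L0 (pref)
open B6CubeWindowV1 (GlobalBand)
open B6Prop26GradKLevelV1L3 (prop26_2136_grad_kLevel_unconditional_pad_V1)
open B6GradLegKLevelV1 (DV)
open BalabanImbrieJaffe1984to88.BIJ85AxialPropagator411 (BondSpace)
open B8ScaledSupNorm (msup)
open LatticeFieldCalculus (laplace)
open B8Prop3MultiLevelTorusLapL0 (prop3_multiLevelTorus_V1_pref_vecLap)

noncomputable section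

open Classical in
/-- ★ **[B8] PROPOSITION 3 AT `U₀ = 1` ON THE `k`-LEVEL V1 TORUS — EVERY ODD `L ≥ 3`, `k ≥ 1`, `P′ ≥ 5L`, NO [B6]-SIDE HYPOTHESIS**: the `L ≥ 3` twin of
`B8Prop3MultiLevelTorusP26L0.prop3_multiLevelTorus_V1_P26_vector` (binders VERBATIM minus `(_ : 4 ≤ ℓ)`, conclusions VERBATIM) — both (2.136)₁ (for `G(1)`) and
(2.136)₂ (for `∇_νG(1)`, `∇_ν = DV ν c′ = c′·(S_ν − 1)`) are the V1L3 lineage's `B6Prop26GradKLevelV1L3.prop26_2136_grad_kLevel_unconditional_pad_V1` for the genuine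
`G` of `D` (one constant `A`, rate `delta3 α (2σ)`, `σ ∈ (0, σ₀]`), fed to `B8Prop3MultiLevelTorusLapL0.prop3_multiLevelTorus_V1_pref_vecLap`; hypotheses left: the V1
torus data, ONE size threshold `M₄ ≤ L·M_h`, `c′ ≠ 0`, the weight band, and the B8-side hypotheses (1.55)/(1.42)/(1.56) + size lines exactly as in the Lap file;
conclusions: the seven of Prop. 3 / (1.59) with `B₀′ = K_L(B₀A + 1)(1 + 2b₁)` and `∇ = DV · c′`.  (p. 87, verbatim: *"then U₁ satisfies (1.36)–(1.39) with
B₁ = 5dLB₀, B₂(β₀) = 5dLB₀(β₀), where B₀, B₀(β₀) are the corresponding norms of the operators G(U₀), H(U₀), and depend on d and L only"*.)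
[cite: Balaban1985RegularSpaces, Prop. 3 p.87, (1.59)–(1.62) pp.86–87, (1.55)–(1.58) p.86, (1.42) p.84; Balaban1984PropagatorsII, Prop. 2.6 (2.136) p.247, (2.92) p.239, Lemma 2.1 p.234; Balaban1984PropagatorsI, (1.4) p.18] -/
theorem prop3_multiLevelTorus_V1_P26_vector_L3 (d ℓ : ℕ) (hd : 1 ≤ d + 1) (hL : Odd (ℓ + 1) ∧ 1 < ℓ + 1) {b₀ b₁ : ℝ} (hb₀ : 0 < b₀) (hb₁ : b₀ ≤ b₁) :
    ∃ σ₀ : ℝ, 0 < σ₀ ∧ ∀ (σ : ℝ), 0 < σ → σ ≤ σ₀ → ∀ (α : ℝ), 0 < α → α < 1 →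
    ∃ B₀ KL : ℝ, 1 ≤ B₀ ∧ 1 ≤ KL ∧
    ∃ Amaj M₄ : ℝ, 0 ≤ Amaj ∧ 0 < M₄ ∧
    ∀ (m K : ℕ) {Mh k R : ℕ} {P' : Fin (d + 1) → ℕ}
      (hN : ∀ μ, N0 ℓ Mh k P' μ = (PV d ℓ m K hd hL).sitesPerDir 0) (D : B6MultiLevelTorusOperatorL0.TDomains d ℓ Mh k P' R) (hk : k ≤ m + K) (_ : 1 ≤ k)
      {a : ℕ} (hMha : Mh = (ℓ + 1) ^ a) (hM8 : 8 ≤ Mh) (_ : 2 * (ℓ + 1) ^ 2 ≤ R) (hP : ∀ μ, 5 * (ℓ + 1) ≤ P' μ)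
      -- ONE size threshold (p38 g30's `M₂` of `prop26_2136_grad_kLevel_unconditional_pad_V1` with this lineage's `M₃`, `N₁ + 1` folded in)
      (_ : M₄ ≤ ((ℓ : ℝ) + 1) * Mh)
      {cf : ℝ} (hcf : cf ≠ 0) {w : BondIdx (domT hN D hk) → ℝ} (hw : ∀ i, 0 < w i) (_ : GlobalBand b₀ b₁ cf w),
      -- line 3 (iv): not a hypothesis (discharged inside the V1L3 producer by `B6Line3CubeV1L3.line3_cube` on `padT D`)
      -- slots 1 AND 2 ((2.136)₁ for `G(1)`, (2.136)₂ for `∇G(1)` with `∇_ν = DV ν c′`): not hypotheses — fed by the V1L3 lineage's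
      -- `B6Prop26GradKLevelV1L3.prop26_2136_grad_kLevel_unconditional_pad_V1` (genuine `G` of `D`, every odd `L ≥ 3`, `k ≥ 1`, `P′ ≥ 5L`, no per-cube hypothesis)
      ∀ (A J : BondSpace (PV d ℓ m K hd hL)) (B : BondIdxSpace (domT hN D hk)),
        dcsE cf (dcE cf A) = J → RE (domT hN D hk) cf (dsE cf A) = 0 → QE (domT hN D hk) A = B →
        ∀ (nJ nB : ℝ), 0 ≤ nJ → 0 ≤ nB →
          (∀ b, |J b| ≤ nJ * (((geomT D).len (blkV1 hN D b) * |cf|⁻¹) ^ 3)⁻¹) →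
          (∀ i, |B i| ≤ nB * (((ℓ : ℝ) + 1) ^ (i.1.1 : ℕ) * |cf|⁻¹)⁻¹) →
        ∀ (dP LP C₂ α₀ α₁ α₂ : ℝ), 0 ≤ dP → 1 ≤ dP * LP → 0 ≤ α₀ → 0 ≤ α₁ → 0 ≤ α₂ →
          nJ ≤ 2 * α₀ + 36 * dP * α₂ *
              msup (ℓ + 1) k |cf|⁻¹ (-2) (fun j (p : Fin (d + 1) × PBond (PV d ℓ m K hd hL) 0) => j ≤ (blkV1 hN D p.2).1.1)
                (fun p : Fin (d + 1) × PBond (PV d ℓ m K hd hL) 0 => DV (P := PV d ℓ m K hd hL) p.1 cf (WithLp.ofLp A) p.2) +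
            50 * dP * α₂ ^ 3 + 10 * dP * α₀ * α₂ →
          nB ≤ 2 * dP * LP * α₁ + C₂ * α₂ ^ 2 →
          36 * dP * (KL * ((B₀ * Amaj + 1) * (1 + 2 * b₁))) * α₂ ≤ 1 / 2 → 50 * dP * α₂ ≤ 1 →
          2 * α₂ ^ 2 + 20 * dP * α₀ * α₂ + 2 * C₂ * α₂ ^ 2 ≤ α₀ + α₁ →
          msup (ℓ + 1) k |cf|⁻¹ (-1) (fun j (b : PBond (PV d ℓ m K hd hL) 0) => j ≤ (blkV1 hN D b).1.1) (WithLp.ofLp A) ≤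
              5 * dP * LP * (KL * ((B₀ * Amaj + 1) * (1 + 2 * b₁))) * (α₀ + α₁) ∧
            msup (ℓ + 1) k |cf|⁻¹ (-2) (fun j (p : Fin (d + 1) × PBond (PV d ℓ m K hd hL) 0) => j ≤ (blkV1 hN D p.2).1.1)
                (fun p : Fin (d + 1) × PBond (PV d ℓ m K hd hL) 0 => DV (P := PV d ℓ m K hd hL) p.1 cf (WithLp.ofLp A) p.2) ≤
              5 * dP * LP * (KL * ((B₀ * Amaj + 1) * (1 + 2 * b₁))) * (α₀ + α₁) ∧
            nJ ≤ 5 * dP * LP * (KL * ((B₀ * Amaj + 1) * (1 + 2 * b₁))) * (α₀ + α₁) ∧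
            msup (ℓ + 1) k |cf|⁻¹ (-3) (fun j (b : PBond (PV d ℓ m K hd hL) 0) => j ≤ (blkV1 hN D b).1.1)
                (fun b : PBond (PV d ℓ m K hd hL) 0 => laplace cf (fun z => A ⟨z, b.dir⟩) b.src) ≤
              5 * dP * LP * (KL * ((B₀ * Amaj + 1) * (1 + 2 * b₁))) * (α₀ + α₁) ∧
            (∀ b : PBond (PV d ℓ m K hd hL) 0,
              |WithLp.ofLp A b| ≤ 5 * dP * LP * (KL * ((B₀ * Amaj + 1) * (1 + 2 * b₁))) * (α₀ + α₁) *
                (((geomT D).len (blkV1 hN D b) * |cf|⁻¹) ^ 1)⁻¹) ∧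
            (∀ (ν : Fin (d + 1)) (b : PBond (PV d ℓ m K hd hL) 0),
              |DV (P := PV d ℓ m K hd hL) ν cf (WithLp.ofLp A) b| ≤ 5 * dP * LP * (KL * ((B₀ * Amaj + 1) * (1 + 2 * b₁))) * (α₀ + α₁) *
                (((geomT D).len (blkV1 hN D b) * |cf|⁻¹) ^ 2)⁻¹) ∧
            (∀ b : PBond (PV d ℓ m K hd hL) 0,
              |laplace cf (fun z => A ⟨z, b.dir⟩) b.src| ≤ 5 * dP * LP * (KL * ((B₀ * Amaj + 1) * (1 + 2 * b₁))) * (α₀ + α₁) *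
                (((geomT D).len (blkV1 hN D b) * |cf|⁻¹) ^ 3)⁻¹) := by
  -- the V1L3 producer's admissible range of rates `(0, σ₁]` for the band `[b₀, b₁]` ((2.136)₁ ∧ (2.136)₂, line 3 and the Lemma-2.1 budget already inside)
  obtain ⟨σ₀, hσ₀, h26⟩ := prop26_2136_grad_kLevel_unconditional_pad_V1 d ℓ hd hL hb₀ hb₁
  refine ⟨σ₀, hσ₀, fun σ hσ hσle α hα0 hα1 => ?_⟩
  -- the decay rate of the delivered majorants and this lineage's constants at that rate
  have hσ' : 0 < delta3 α (2 * σ) := delta3_pos hα1 (by positivity)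
  obtain ⟨B₀, KL, M₃, N₁, hB₀, hKL, hM₃, hN₁, hS⟩ := prop3_multiLevelTorus_V1_pref_vecLap d ℓ hd hL hσ'
  refine ⟨B₀, KL, hB₀, hKL, ?_⟩
  -- p38's constants `A, M₂` (ONE constant for both slots); ONE threshold `M₄ := max M₂ (max M₃ (N₁ + 1))`
  obtain ⟨Amaj, M₂, hA, hM₂, hG26⟩ := h26 σ hσ hσle α hα0 hα1.le
  refine ⟨Amaj, max M₂ (max M₃ ((N₁ : ℝ) + 1)), hA, lt_max_of_lt_left hM₂, ?_⟩
  intro m K Mh k R P' hN D hk hk1 a hMha hM8 hR2 hP hM4t cf hcf w hw hwb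
    A J B h55 h42 h56 nJ nB hnJ hnB hJ hB dP LP C₂ α₀ α₁ α₂ hdP hdL hα₀ hα₁ hα₂ h55s h56s hside h50 h61
  -- the single threshold implies the three it replaces
  have hM2t : M₂ ≤ ((ℓ : ℝ) + 1) * Mh := le_trans (le_max_left _ _) hM4t
  have hM3t : M₃ ≤ ((ℓ : ℝ) + 1) * Mh := le_trans ((le_max_left _ _).trans (le_max_right _ _)) hM4t
  have hN1r : (N₁ : ℝ) + 1 ≤ ((ℓ : ℝ) + 1) * Mh := le_trans ((le_max_right _ _).trans (le_max_right _ _)) hM4t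
  have hN1t : N₁ + 1 ≤ R * ((ℓ + 1) * Mh) := by
    have h1 : N₁ + 1 ≤ (ℓ + 1) * Mh := by exact_mod_cast hN1r
    have hR1 : 1 ≤ R := le_trans (Nat.one_le_iff_ne_zero.mpr (by positivity)) hR2
    calc N₁ + 1 ≤ (ℓ + 1) * Mh := h1
      _ = 1 * ((ℓ + 1) * Mh) := (one_mul _).symm
      _ ≤ R * ((ℓ + 1) * Mh) := Nat.mul_le_mul_right _ hR1
  -- slot 1 AND slot 2 = p38's conclusion for the genuine `G` of `D` at the rate `2σ`, literally (`Dop ν := DV ν c′`)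
  obtain ⟨hG, hD⟩ := hG26 m K hN D hk hk1 hMha hM8 hR2 hP hM2t hcf hw hwb
  -- the producer's thresholds imply this lineage's
  have hMh1 : 1 ≤ Mh := le_trans (by norm_num) hM8
  have hR2' : 2 * (ℓ + 1) ≤ R := by
    have h1 : ℓ + 1 ≤ (ℓ + 1) ^ 2 := by nlinarith
    exact le_trans (Nat.mul_le_mul_left 2 h1) hR2
  have hP4 : ∀ μ, 4 ≤ P' μ := fun μ => le_trans (by omega) (hP μ)
  exact hS k Mh R (by omega) hMh1 hN1t hR2' hM3t P' hP4 D m K hN hk cf hcf w hw b₀ b₁ hb₀.le (hb₀.le.trans hb₁) hwb Amaj hA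
    (fun ν => DV (P := PV d ℓ m K hd hL) ν cf) hG hD
    A J B h55 h42 h56 nJ nB hnJ hnB hJ hB dP LP C₂ α₀ α₁ α₂ hdP hdL hα₀ hα₁ hα₂ h55s h56s hside h50 h61

end

end Literature.MathematicalPhysics.QuantumFieldTheory.Balaban1983to89.B8Prop3MultiLevelTorusP26L3
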